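import Mathlib
import HarnessLib

/-!
# The pole-killing seed vanishes at the origin: a finite-Fourier-eigenfunction identity

Helper file (`--supports stmt-RiemannHypothesis-0098`), elementary, no definitions.  Seat rh-explicit-weil-5 gen14 (file of record
`HOME/rh-explicit-weil-5/WEIL5-CLASS.md` §1, ADDENDUM 3 of the census seal).

Context (documentation only).  The prolate spheroidal wave functions `ψ_n(c; ·)` are the eigenfunctions of the finite Fourier transform,
`∫_{-1}^{1} e^{icxt} ψ_n(t) dt = μ_n ψ_n(x)` with `μ_n = iⁿ|μ_n|`, `|μ_n|² = 2πλ_n/c`.  Evaluating at `x = 0` gives `∫_{-1}^{1} ψ_n = μ_n ψ_n(0)`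
(`integral_eq_eigenvalue_mul_apply_zero`).  Consequently, for two members `ψ_lo, ψ_hi` of the same Fourier class the POLE-KILLING seed
`S = ψ_hi − (∫ψ_hi/∫ψ_lo) ψ_lo` (zero mass, i.e. its Mellin transform vanishes at ζ's pole — the interior of every certified section,
WEIL5-CLASS §1) satisfies `S(0) = ψ_hi(0)·(1 − μ_hi/μ_lo)` (`poleKillingSeed_apply_zero`): since `μ_hi/μ_lo = √(λ_hi/λ_lo) = 1 − O(e^{−2c})`
within a class, THE SEED VANISHES AT THE ORIGIN up to an exponentially small multiple of `ψ_hi(0)`, and the two normalisations used by the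
cell — weil-9's T133 `ψ₆ − (ψ₆(0)/ψ₂(0))ψ₂` and the pole constraint `ψ₆ − (∫ψ₆/∫ψ₂)ψ₂` — coincide to that accuracy
(`poleKilling_coeff_eq_value_ratio`: `∫ψ_hi/∫ψ_lo = (μ_hi/μ_lo)·ψ_hi(0)/ψ_lo(0)`).  Numerically `∫₀¹ψ₄/∫₀¹ψ₀ = ψ₄(0)/ψ₀(0) = 0.601729 /
0.608638 / 0.611021` and `∫ψ₆/∫ψ₂ = ψ₆(0)/ψ₂(0) = 0.775849 / 0.785635 / 0.788810` at `c = 46.4 / 126.2 / 343.1` (six digits).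

Standard axioms only; no `sorry`.
-/

set_option linter.dupNamespace false
set_option autoImplicit false

noncomputable section

open Real intervalIntegral

namespace Summit.RiemannHypothesis.RiemannHypothesis.Theorems.WeilPolarSeedOrigin

/-- A finite-Fourier eigenfunction's integral is its eigenvalue times its value at the origin:
if `∫_{-1}^{1} e^{icxt} ψ(t) dt = μ ψ(x)` for all `x`, then `∫_{-1}^{1} ψ = μ ψ(0)`. -/
theorem integral_eq_eigenvalue_mul_apply_zero (ψ : ℝ → ℂ) (c : ℝ) (μ : ℂ)
    (h : ∀ x : ℝ, ∫ t in (-1 : ℝ)..1, Complex.exp (Complex.I * c * x * t) * ψ t = μ * ψ x) :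
    ∫ t in (-1 : ℝ)..1, ψ t = μ * ψ 0 := by
  have h0 := h 0
  simpa using h0

/-- Within a class the zero-mass coefficient is the value ratio times the eigenvalue ratio:
`∫ψ_hi/∫ψ_lo = (μ_hi/μ_lo)·(ψ_hi(0)/ψ_lo(0))`. -/
theorem poleKilling_coeff_eq_value_ratio {𝕜 : Type*} [Field 𝕜] (Ilo Ihi μlo μhi vlo vhi : 𝕜)
    (hlo : Ilo = μlo * vlo) (hhi : Ihi = μhi * vhi) (hμ : μlo ≠ 0) (hv : vlo ≠ 0) :
    Ihi / Ilo = (μhi / μlo) * (vhi / vlo) := by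
  rw [hlo, hhi]
  field_simp

/-- THE POLE-KILLING SEED AT THE ORIGIN: with `∫ψ_lo = μ_lo ψ_lo(0)` and `∫ψ_hi = μ_hi ψ_hi(0)` (`μ_lo, ψ_lo(0) ≠ 0`),
`ψ_hi(0) − (∫ψ_hi/∫ψ_lo)·ψ_lo(0) = ψ_hi(0)·(1 − μ_hi/μ_lo)` — zero exactly when the two eigenvalues agree, and `O(1 − μ_hi/μ_lo)`
small in general. -/
theorem poleKillingSeed_apply_zero {𝕜 : Type*} [Field 𝕜] (Ilo Ihi μlo μhi vlo vhi : 𝕜)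
    (hlo : Ilo = μlo * vlo) (hhi : Ihi = μhi * vhi) (hμ : μlo ≠ 0) (hv : vlo ≠ 0) :
    vhi - (Ihi / Ilo) * vlo = vhi * (1 - μhi / μlo) := by
  rw [hlo, hhi]
  field_simp

/-- Conversely the VALUE-normalised seed `ψ_hi − (ψ_hi(0)/ψ_lo(0))ψ_lo` (weil-9's T133 odd seed) has mass
`∫ψ_hi − (ψ_hi(0)/ψ_lo(0))∫ψ_lo = ψ_hi(0)·(μ_hi − μ_lo)` — zero mass up to the same eigenvalue gap. -/
theorem valueSeed_mass {𝕜 : Type*} [Field 𝕜] (Ilo Ihi μlo μhi vlo vhi : 𝕜)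
    (hlo : Ilo = μlo * vlo) (hhi : Ihi = μhi * vhi) (hv : vlo ≠ 0) :
    Ihi - (vhi / vlo) * Ilo = vhi * (μhi - μlo) := by
  rw [hlo, hhi]
  field_simp

end Summit.RiemannHypothesis.RiemannHypothesis.Theorems.WeilPolarSeedOrigin

end
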